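import Summits.ABC.StewartYu.PadicTwoSetup
import HarnessLib

/-!
# Cell abc-stewartyu, W80Two (ii): the `2`-adic set-up — exponents of the auxiliary functions and
# the values of the exponentials at the integer and THIRD points

`Summits/ABC/StewartYu/PadicTwoValues.lean` — cell `abc-stewartyu` (seat lit; crux `W80Two`
stmt-ABC-19486), sequel to `PadicTwoSetup.lean`; the `p = 2`, `q = 3` twin of p2's
`PadicTwistValues.lean`.  Plain definitions and theorems; no named fact.

For `S : TwoSetup` (generators `allᵢ ≡ 1 (mod 8)`, `ωᵢ = allᵢ ∈ ℚ₂`, `‖log₂ ωᵢ‖ ≤ 8⁻¹`): the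
exponents `ψ_u = ∑ λⱼ log₂ αⱼ + λ_θ log₂ θ`, `expo u = ψ_u + λ_θ Λ₀ = ∑ γⱼ log₂ αⱼ` (norms `≤ 8⁻¹`, so
`z ↦ exp(z ψ_u)` is analytic on `‖z‖ ≤ 2`), and the two value identities of the `q = 3` descent:
* `exp_ψ_natCast`: `exp(s ψ_u) = qE(u,s)` (no twist at `p = 2`);
* `exp_ψ_third_natCast`: `exp(s ψ_u · 3⁻¹) = ∏ᵢ cbrtᵢ^{expnᵢ(u,s)}` on the principal CUBE roots
  `cbrtᵢ = exp(3⁻¹ · log₂ ωᵢ) ∈ ℚ₂` (`cbrtᵢ³ = ωᵢ`, `‖cbrtᵢ − 1‖ ≤ 8⁻¹`; p1's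
  `PadicTwoAdicCubeRoot.lean`), whose cube is `qE(u,s)`.
The class separation of the third step (the `3^{d+1}` classes `λ (mod 3)`) is lit's
`Literature.Barriers.ABC.linearIndependent_prod_pow_cbrt_primes_sq_rat` /
`Summit.ABC.StewartYu.Multicub.*`; it is not used here.

## References
* [Yu1990] K. Yu, *Linear forms in p-adic logarithms II*, Compositio Math. 74 (1990), §1.1, §3.
* [Koblitz1984] N. Koblitz, GTM 58, Ch. IV §1–2.
* [CijsouwWaldschmidt1977] P. L. Cijsouw, M. Waldschmidt, Compositio Math. 34 (1977), §4.
-/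

noncomputable section

open NormedSpace Finset IsUltrametricDist
open Literature.NumberTheory.Transcendental
open Literature.NumberTheory.Transcendental.CW77.Setup (Idx Tau tauNorm)
open scoped Nat

namespace Summit.ABC.StewartYu

namespace TwoSetup

variable (S : TwoSetup) {h Lb : ℕ}

/-! ### The exponents of the auxiliary functions -/

/-- The exact exponent `ψ_u = ∑ λⱼ lg j + λ_θ lgθ` (of `φ`). [cite: CijsouwWaldschmidt1977, §4 (p. 185)] -/
def ψ (u : Idx S.d h Lb) : ℚ_[2] := ∑ j, (u.2.1 j : ℚ_[2]) * S.lg j + (u.2.2 : ℚ_[2]) * S.lgθ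

/-- The perturbed exponent `expo u = ψ_u + λ_θ Λ₀` (of `f`). [cite: CijsouwWaldschmidt1977, §4 (p. 184)] -/
def expo (u : Idx S.d h Lb) : ℚ_[2] := S.ψ u + (u.2.2 : ℚ_[2]) * S.Λ₀

/-- **The identity behind `f`**: `expo u = ∑ⱼ γⱼ(u) lg j`. [cite: CijsouwWaldschmidt1977, §4 (p. 184)] -/
theorem expo_eq (u : Idx S.d h Lb) :
    S.expo u = ∑ j : Fin S.d, (S.frame.γ u j : ℚ_[2]) * S.lg j := by
  unfold expo ψ Λ₀ CW77.Setup.γ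
  push_cast
  simp only [add_mul, sum_add_distrib, mul_sum, mul_sub]
  ring

/-- `‖ψ_u‖ ≤ 8⁻¹`. [cite: Yu1990, §1.1] -/
theorem norm_ψ_le (u : Idx S.d h Lb) : ‖S.ψ u‖ ≤ (8 : ℝ)⁻¹ := by
  unfold ψ
  refine (norm_add_le_max _ _).trans (max_le ?_ ?_)
  · refine IsUltrametricDist.norm_sum_le_of_forall_le_of_nonneg eighth_nonneg fun j _ => ?_
    rw [norm_mul]
    refine (mul_le_of_le_one_left (norm_nonneg _) ?_).trans (S.norm_lg_le j)
    exact_mod_cast Padic.norm_int_le_one (p := 2) (u.2.1 j : ℤ)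
  · rw [norm_mul]
    refine (mul_le_of_le_one_left (norm_nonneg _) ?_).trans S.norm_lgθ_le
    exact_mod_cast Padic.norm_int_le_one (p := 2) (u.2.2 : ℤ)

/-- `‖ψ_u‖ < 2⁻¹`. [folklore] -/
theorem norm_ψ_lt (u : Idx S.d h Lb) : ‖S.ψ u‖ < ((2 : ℕ) : ℝ)⁻¹ :=
  (S.norm_ψ_le u).trans_lt eighth_lt_half

/-- `‖expo u‖ ≤ 8⁻¹`. [cite: Yu1990, §1.1] -/
theorem norm_expo_le (u : Idx S.d h Lb) : ‖S.expo u‖ ≤ (8 : ℝ)⁻¹ := by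
  rw [S.expo_eq]
  refine IsUltrametricDist.norm_sum_le_of_forall_le_of_nonneg eighth_nonneg fun j _ => ?_
  rw [norm_mul]
  exact (mul_le_of_le_one_left (norm_nonneg _) (S.norm_γ_le u j)).trans (S.norm_lg_le j)

/-- `‖expo u‖ < 2⁻¹`. [folklore] -/
theorem norm_expo_lt (u : Idx S.d h Lb) : ‖S.expo u‖ < ((2 : ℕ) : ℝ)⁻¹ :=
  (S.norm_expo_le u).trans_lt eighth_lt_half

/-- `‖λ_θ Λ₀‖ ≤ ‖Λ₀‖`. [folklore] -/
theorem norm_natCast_mul_Λ₀_le (n : ℕ) : ‖(n : ℚ_[2]) * S.Λ₀‖ ≤ ‖S.Λ₀‖ := by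
  rw [norm_mul]
  refine mul_le_of_le_one_left (norm_nonneg _) ?_
  exact_mod_cast Padic.norm_int_le_one (p := 2) (n : ℤ)

/-- `ψ_u · s = ∑ᵢ expnᵢ(u,s) · log₂ ωᵢ`. [folklore] -/
theorem ψ_mul_natCast (u : Idx S.d h Lb) (s : ℕ) :
    S.ψ u * (s : ℚ_[2]) = ∑ i : Fin (S.d + 1), (S.frame.expn u s i : ℚ_[2]) * S.lgAll i := by
  unfold ψ lg lgθ
  rw [Fin.sum_univ_castSucc]
  have e1 : ∀ j : Fin S.d, S.frame.expn u s (Fin.castSucc j) = u.2.1 j * s :=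
    fun j => SetupQ.flat_expn_castSucc S.toQ u s j
  have e2 : S.frame.expn u s (Fin.last S.d) = u.2.2 * s := SetupQ.flat_expn_last S.toQ u s
  simp only [e1, e2]
  push_cast
  rw [add_mul, sum_mul]
  congr 1
  · exact sum_congr rfl fun j _ => by ring
  · ring

/-! ### The values at the integers -/

/-- **`exp (s ψ_u) = qE(u, s)`** at a natural number `s` (no twist at `p = 2`).
[cite: CijsouwWaldschmidt1977, §4 (p. 186)] -/
theorem exp_ψ_natCast (u : Idx S.d h Lb) (s : ℕ) :
    exp (S.ψ u * (s : ℚ_[2])) = (S.toQ.qE u s : ℚ_[2]) := by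
  rw [S.ψ_mul_natCast]
  unfold lgAll
  rw [PadicExp.exp_sum_mul_plog (ℓ := 2) univ _ _ (fun i _ => S.norm_one_sub_ω_lt i)
    (fun i _ => by exact_mod_cast Padic.norm_int_le_one (p := 2) (S.frame.expn u s i : ℤ))]
  rw [S.toQ.qE_eq_prod_all]; push_cast
  refine prod_congr rfl fun i _ => ?_
  rw [PadicExp.exp_natCast_mul_plog_of_norm_lt (ℓ := 2) (S.norm_one_sub_ω_lt i)]
  rfl

/-- `exp (s ψ_u)` is a principal unit: `‖1 − exp(s ψ_u)‖ < 2⁻¹`. [folklore] -/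
theorem norm_one_sub_exp_ψ_natCast_lt (u : Idx S.d h Lb) (s : ℕ) :
    ‖1 - exp (S.ψ u * (s : ℚ_[2]))‖ < ((2 : ℕ) : ℝ)⁻¹ := by
  have hlt : ‖S.ψ u * (s : ℚ_[2])‖ < ((2 : ℕ) : ℝ)⁻¹ := by
    rw [norm_mul]
    refine (mul_le_of_le_one_right (norm_nonneg _) ?_).trans_lt (S.norm_ψ_lt u)
    exact_mod_cast Padic.norm_int_le_one (p := 2) (s : ℤ)
  rw [norm_sub_rev, PadicExp.norm_exp_sub_one (ℓ := 2) hlt]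
  exact hlt

/-! ### The principal cube roots and the values at the third points -/

/-- **The principal cube root `cbrtᵢ = exp(3⁻¹ · log₂ ωᵢ) ∈ ℚ₂`** of the generator `allᵢ`.
[cite: Yu1990, §3 (q = 3)] -/
def cbrt (i : Fin (S.d + 1)) : ℚ_[2] := exp (((3 : ℕ) : ℚ_[2])⁻¹ * S.lgAll i)

/-- `cbrtᵢ = exp (3⁻¹ · plog allᵢ)`. [folklore] -/
theorem cbrt_def (i : Fin (S.d + 1)) :
    S.cbrt i = exp (((3 : ℕ) : ℚ_[2])⁻¹ * PadicExp.plog (S.toQ.all i : ℚ_[2])) := rfl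

/-- **`cbrtᵢ³ = allᵢ`.** [cite: Koblitz1984, Ch. IV §2] -/
theorem cbrt_pow_three (i : Fin (S.d + 1)) : S.cbrt i ^ 3 = S.ω i :=
  TwoAdic.cbrt_pow_three (S.three_le_padicValRat_all i)

/-- The cube root is again `≡ 1 (mod 8)`: `‖cbrtᵢ − 1‖ = ‖1 − ωᵢ‖ ≤ 8⁻¹`. [cite: Koblitz1984, Ch. IV §2] -/
theorem norm_cbrt_sub_one (i : Fin (S.d + 1)) : ‖S.cbrt i - 1‖ = ‖1 - S.ω i‖ :=
  TwoAdic.norm_cbrt_sub_one (S.three_le_padicValRat_all i)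

/-- `‖cbrtᵢ − 1‖ ≤ 8⁻¹`. [folklore] -/
theorem norm_cbrt_sub_one_le (i : Fin (S.d + 1)) : ‖S.cbrt i - 1‖ ≤ (8 : ℝ)⁻¹ := by
  rw [S.norm_cbrt_sub_one]; exact S.norm_one_sub_ω_le i

/-- **The cube roots and their powers are units**: `‖cbrtᵢⁿ‖ = 1` (`n = 1`: `‖cbrtᵢ‖ = 1`).
[folklore] -/
theorem norm_cbrt_pow (i : Fin (S.d + 1)) (n : ℕ) : ‖S.cbrt i ^ n‖ = 1 := by
  have h1 : ‖S.cbrt i‖ = 1 := by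
    refine IwasawaLog.norm_eq_one_of_norm_one_sub_lt ?_
    rw [norm_sub_rev, S.norm_cbrt_sub_one]
    exact S.norm_one_sub_ω_lt_one i
  rw [norm_pow, h1, one_pow]

/-- **`exp (s ψ_u · 3⁻¹) = ∏ᵢ cbrtᵢ^{expnᵢ(u,s)}`**: the value of `z ↦ exp(z ψ_u)` at the third point
`s/3` is a monomial in the principal cube roots. [cite: Yu1990, §3 (3.5)] -/
theorem exp_ψ_third_natCast (u : Idx S.d h Lb) (s : ℕ) :
    exp (S.ψ u * (s : ℚ_[2]) * ((3 : ℕ) : ℚ_[2])⁻¹) =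
      ∏ i : Fin (S.d + 1), S.cbrt i ^ S.frame.expn u s i := by
  have e : S.ψ u * (s : ℚ_[2]) * ((3 : ℕ) : ℚ_[2])⁻¹ =
      ∑ i : Fin (S.d + 1), (S.frame.expn u s i : ℚ_[2]) * ((((3 : ℕ) : ℚ_[2])⁻¹) * S.lgAll i) := by
    rw [S.ψ_mul_natCast, sum_mul]
    exact sum_congr rfl fun i _ => by ring
  rw [e]
  unfold lgAll cbrt
  exact PadicExp.exp_sum_natCast_mul_mul_plog (ℓ := 2) univ _ _ (fun i _ => S.norm_one_sub_ω_lt i)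
    (le_of_eq TwoAdic.norm_inv_three_two)

/-- The values at the third points are units: `‖∏ᵢ cbrtᵢ^{expnᵢ}‖ = 1`. [folklore] -/
theorem norm_prod_cbrt_pow (u : Idx S.d h Lb) (s : ℕ) :
    ‖∏ i : Fin (S.d + 1), S.cbrt i ^ S.frame.expn u s i‖ = 1 := by
  rw [norm_prod]
  exact prod_eq_one fun i _ => S.norm_cbrt_pow i _

/-- **Cubing the third-point value recovers the integer value**:
`(∏ᵢ cbrtᵢ^{expnᵢ(u,s)})³ = qE(u,s)`. [cite: Yu1990, §3] -/
theorem prod_cbrt_pow_pow_three (u : Idx S.d h Lb) (s : ℕ) :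
    (∏ i : Fin (S.d + 1), S.cbrt i ^ S.frame.expn u s i) ^ 3 = (S.toQ.qE u s : ℚ_[2]) := by
  rw [← prod_pow, S.toQ.qE_eq_prod_all]; push_cast
  refine prod_congr rfl fun i _ => ?_
  rw [← pow_mul, mul_comm, pow_mul, S.cbrt_pow_three]
  rfl

end TwoSetup

end Summit.ABC.StewartYu

end
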